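import Literature.Probability.Percolation.ConditionalPositiveAssociationProofs
import Literature.Probability.Percolation.TwoClusterConditionalAssociationProofs

/-!
# Conditional Harris inequalities off the cluster of a source, given a disconnection

Support file for crux `stmt-CriticalPhenomena-4575` (master-family programme, row `Q44`, single-source packing; MONO-A
line), seat `prim-bnk-1` gen 33; memo `run/shared/lean/prim/prim-l12/FROM-prim-bnk-1-gen33-LAW-LEVEL-MONO-A.md` §2.
Bernoulli bond percolation with arbitrary edge probabilities on a finite vertex type (finite weighted sums `Σ_ω weight(ω) …`
of `BHK2006`), a source `s`, a set `X ∌ s`, `D = {s ↮ X}`.  A function `φ` of the configuration LIVES OFF THE CLUSTER of `s`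
on `D` if there `φ ω = φ (ω ∖ W̄(C_s ω))`, `W̄(W)` = the pairs meeting `{s} ∪ V(W)` (e.g. `1{a ↔ b}`, `a ∈ X`).  Conditioning
on `C_s = W` (block Fubini, BHK's display (10)) turns `φ` into the conditional average `Σ_η weight(η) φ(η ∖ W̄)`, ANTITONE in
`W` for increasing `φ`; Harris holds in the fresh variables; and BHK's Theorem 1.3 (conditional positive association of `C_s`
given `D`; PROVED in the tree, `BHK2006_clusterConditionalPositiveAssociation_holds`) recombines the averages:
* `sum_cluster_fubini`, `sum_offCluster_eq_cond` — `E[H(C_s) φ ; D] = E[H(C_s) · cond φ (C_s) ; D]`;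
* `thm13_sum` — Theorem 1.3 as a finite-sum inequality for arbitrary monotone `F, G`;
* `condHarris_cluster_mono_off_mono` / `condHarris_cluster_anti_off_mono` — given `D`, an increasing function of `C_s` and an
  increasing off-cluster function are NEGATIVELY correlated; a decreasing one and an increasing off-cluster function POSITIVELY;
* `condHarris_off_mono_mono` / `condHarris_off_mono_anti` — given `D`, two increasing off-cluster functions are positively
  correlated, an increasing and a decreasing one negatively.
These are the law-level tools behind the new four-point exchange inequalities of types B and D (`…FourPointExchangeBD`) and
hence behind E-MONO-A for terminal–terminal source edges.  No named facts, no sorries, no definitions.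
-/
noncomputable section

namespace Summit.CriticalPhenomena.PercolationContinuityZ3.Theorems

namespace CondHarris

open MeasureTheory Set Literature.Probability.Percolation Literature.Probability.Percolation.BHK2006
open Literature.Probability.LatticeModels (prodBernoulli)
open DecisionTree (ind ind_of_mem ind_of_not_mem ind_nonneg)
open scoped Classical

variable {V : Type*}

/-! ## The closed neighbourhood of a cluster and functions living off it -/

/- Conventions, written out in full below (no definitions are introduced): `W̄(W) = {e | ∃ v ∈ e, v = s ∨ ∃ e' ∈ W, v ∈ e'}`
are the pairs meeting `{s} ∪ V(W)` (BHK p. 7); `Σ_η weight(η) φ(η ∖ W̄(W))` is the conditional average of `φ` given `C_s = W`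
(BHK p. 8); `{ω | ∀ x ∈ X, ¬ s ↔ x}` is BHK's `R_X = {s ↮ X}`; `fun e => (w e : ℝ)` are the real parameters of `w`. -/

/-- `W̄` is monotone in `W`. [folklore] -/
theorem bar_mono' (s : V) : Monotone (fun W : Set (Sym2 V) => {e : Sym2 V | ∃ v ∈ e, v = s ∨ ∃ e' ∈ W, v ∈ e'}) :=
  BHK2006.bar_mono s

/-- A vertex outside `{s} ∪ V(C_s)` is joined to another vertex in `ω` iff it is in `ω ∖ W̄(C_s ω)`: connections away
from the cluster of `s` do not use the pairs meeting it. [folklore] -/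
theorem reachable_iff_reachable_sdiff_bar {s t u : V} {ω : Set (Sym2 V)}
    (ht : ¬ (openGraph ω).Reachable s t) :
    (openGraph ω).Reachable t u ↔ (openGraph (ω \ {e : Sym2 V | ∃ v ∈ e, v = s ∨ ∃ e' ∈ openEdgeCluster ω s, v ∈ e'})).Reachable t u := by
  have ht' : ¬ (t = s ∨ ∃ e ∈ openEdgeCluster ω s, t ∈ e) := fun h =>
    ht ((reachable_iff_exists_mem_openEdgeCluster ω s t).2 h)
  have hC := BHK2006.openEdgeCluster_eq_sdiff_bar (s := s) (t := t) (W := openEdgeCluster ω s) rfl ht'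
  rw [reachable_iff_exists_mem_openEdgeCluster, reachable_iff_exists_mem_openEdgeCluster, hC]

variable [Fintype V]

/-! ## Conditioning on the cluster of the source (block Fubini) -/

/-- **Conditioning on `C_s = W`** (BHK's display (10), domain Markov property): for any `Ψ`,
`Σ_ω weight(ω) Ψ(C_s ω, ω ∖ W̄(C_s ω)) = Σ_ω weight(ω) Σ_η weight(η) Ψ(C_s ω, η ∖ W̄(C_s ω))`.
[cite: VandenbergHaggstromKahn2005, §1 pp. 7–8, display (10)] -/
theorem sum_cluster_fubini (w : Sym2 V → ℝ) (hm : ∑ ω, weight w ω = 1) (s : V)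
    (Ψ : Set (Sym2 V) → Set (Sym2 V) → ℝ) :
    ∑ ω, weight w ω * Ψ (openEdgeCluster ω s) (ω \ {e : Sym2 V | ∃ v ∈ e, v = s ∨ ∃ e' ∈ openEdgeCluster ω s, v ∈ e'}) =
      ∑ ω, weight w ω * ∑ η, weight w η * Ψ (openEdgeCluster ω s) (η \ {e : Sym2 V | ∃ v ∈ e, v = s ∨ ∃ e' ∈ openEdgeCluster ω s, v ∈ e'}) := by
  have key : ∀ W : Set (Sym2 V),
      ∑ ω, (if openEdgeCluster ω s = W then weight w ω * Ψ W (ω \ {e : Sym2 V | ∃ v ∈ e, v = s ∨ ∃ e' ∈ W, v ∈ e'}) else 0) =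
      ∑ ω, (if openEdgeCluster ω s = W then weight w ω * ∑ η, weight w η * Ψ W (η \ {e : Sym2 V | ∃ v ∈ e, v = s ∨ ∃ e' ∈ W, v ∈ e'}) else 0) := by
    intro W
    set A : Set (Sym2 V) := {e : Sym2 V | ∃ v ∈ e, v = s ∨ ∃ e' ∈ W, v ∈ e'} with hA
    set Φ : Set (Sym2 V) → Set (Sym2 V) → ℝ := fun ζ η =>
      if openEdgeCluster ζ s = W then Ψ W (η \ A) else 0 with hΦ
    have h1 : ∀ ω, (if openEdgeCluster ω s = W then weight w ω * Ψ W (ω \ A) else 0) =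
        weight w ω * Φ (ω ∩ A) (ω \ A) := by
      intro ω
      have hiff : openEdgeCluster (ω ∩ A) s = W ↔ openEdgeCluster ω s = W := by
        rw [hA]; exact BHK2006.openEdgeCluster_inter_bar_eq_iff s W ω
      simp only [hΦ]
      by_cases hW : openEdgeCluster ω s = W
      · rw [if_pos hW, if_pos (hiff.2 hW), Set.sdiff_sdiff, Set.union_self]
      · rw [if_neg hW, if_neg (fun h => hW (hiff.1 h)), mul_zero]
    have h2 : ∀ ω, weight w ω * ∑ ω', weight w ω' * Φ (ω ∩ A) (ω' \ A) =
        (if openEdgeCluster ω s = W then weight w ω * ∑ η, weight w η * Ψ W (η \ A) else 0) := by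
      intro ω
      have hiff : openEdgeCluster (ω ∩ A) s = W ↔ openEdgeCluster ω s = W := by
        rw [hA]; exact BHK2006.openEdgeCluster_inter_bar_eq_iff s W ω
      simp only [hΦ]
      by_cases hW : openEdgeCluster ω s = W
      · rw [if_pos hW]
        refine congrArg _ (Finset.sum_congr rfl fun η _ => ?_)
        rw [if_pos (hiff.2 hW), Set.sdiff_sdiff, Set.union_self]
      · rw [if_neg hW]
        have : ∀ η : Set (Sym2 V), weight w η * (if openEdgeCluster (ω ∩ A) s = W then Ψ W ((η \ A) \ A) else 0) = 0 :=
          fun η => by rw [if_neg (fun h => hW (hiff.1 h)), mul_zero]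
        rw [Finset.sum_congr rfl fun η _ => this η, Finset.sum_const_zero, mul_zero]
    calc ∑ ω, (if openEdgeCluster ω s = W then weight w ω * Ψ W (ω \ {e : Sym2 V | ∃ v ∈ e, v = s ∨ ∃ e' ∈ W, v ∈ e'}) else 0)
        = (∑ ω, weight w ω) * ∑ ω, weight w ω * Φ (ω ∩ A) (ω \ A) := by
          rw [hm, one_mul]; exact Finset.sum_congr rfl fun ω _ => h1 ω
      _ = ∑ ω, weight w ω * ∑ ω', weight w ω' * Φ (ω ∩ A) (ω' \ A) := blockFubini w A Φ
      _ = _ := Finset.sum_congr rfl fun ω _ => h2 ω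
  calc ∑ ω, weight w ω * Ψ (openEdgeCluster ω s) (ω \ {e : Sym2 V | ∃ v ∈ e, v = s ∨ ∃ e' ∈ openEdgeCluster ω s, v ∈ e'})
      = ∑ ω, ∑ W, (if openEdgeCluster ω s = W then weight w ω * Ψ W (ω \ {e : Sym2 V | ∃ v ∈ e, v = s ∨ ∃ e' ∈ W, v ∈ e'}) else 0) :=
        Finset.sum_congr rfl fun ω _ =>
          (Fintype.sum_ite_eq (openEdgeCluster ω s) fun W => weight w ω * Ψ W (ω \ {e : Sym2 V | ∃ v ∈ e, v = s ∨ ∃ e' ∈ W, v ∈ e'})).symm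
    _ = ∑ W, ∑ ω, (if openEdgeCluster ω s = W then weight w ω * Ψ W (ω \ {e : Sym2 V | ∃ v ∈ e, v = s ∨ ∃ e' ∈ W, v ∈ e'}) else 0) :=
        Finset.sum_comm
    _ = ∑ W, ∑ ω, (if openEdgeCluster ω s = W then
          weight w ω * ∑ η, weight w η * Ψ W (η \ {e : Sym2 V | ∃ v ∈ e, v = s ∨ ∃ e' ∈ W, v ∈ e'}) else 0) :=
        Finset.sum_congr rfl fun W _ => key W
    _ = ∑ ω, ∑ W, (if openEdgeCluster ω s = W then
          weight w ω * ∑ η, weight w η * Ψ W (η \ {e : Sym2 V | ∃ v ∈ e, v = s ∨ ∃ e' ∈ W, v ∈ e'}) else 0) := Finset.sum_comm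
    _ = _ := Finset.sum_congr rfl fun ω _ =>
          Fintype.sum_ite_eq (openEdgeCluster ω s) fun W => weight w ω * ∑ η, weight w η * Ψ W (η \ {e : Sym2 V | ∃ v ∈ e, v = s ∨ ∃ e' ∈ W, v ∈ e'})

/-! ## The disconnection event and the decomposition of off-cluster functions -/

/-- `{s ↮ X}` read off the cluster: `1_D(ω) = dD(C_s ω)` with `dD W = 1{∀ x ∈ X, ¬(x = s ∨ ∃ e ∈ W, x ∈ e)}`.
[folklore] -/
theorem ind_Dis_eq (s : V) (X : Set V) (ω : Set (Sym2 V)) :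
    ind ({ω : Set (Sym2 V) | ∀ t ∈ X, ¬ (openGraph ω).Reachable s t}) ω = if (∀ x ∈ X, ¬ (x = s ∨ ∃ e ∈ openEdgeCluster ω s, x ∈ e)) then 1 else 0 := by
  by_cases h : ω ∈ {ω : Set (Sym2 V) | ∀ t ∈ X, ¬ (openGraph ω).Reachable s t}
  · rw [ind_of_mem h, if_pos]
    intro x hx hx'
    exact h x hx ((reachable_iff_exists_mem_openEdgeCluster ω s x).2 hx')
  · rw [ind_of_not_mem h, if_neg]
    intro h'
    exact h fun x hx hr => h' x hx ((reachable_iff_exists_mem_openEdgeCluster ω s x).1 hr)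

/-- **Decomposition of an off-cluster function**: if `φ ω = φ (ω ∖ W̄(C_s ω))` on `D = {s ↮ X}`, then for every `H`,
`E[H(C_s) φ ; D] = E[H(C_s) · cond φ (C_s) ; D]`. [cite: VandenbergHaggstromKahn2005, §1 pp. 7–8 (display (10))] -/
theorem sum_offCluster_eq_cond (w : Sym2 V → ℝ) (hm : ∑ ω, weight w ω = 1) (s : V) (X : Set V)
    (H : Set (Sym2 V) → ℝ) (φ : Set (Sym2 V) → ℝ)
    (hφ : ∀ ω, ω ∈ {ω : Set (Sym2 V) | ∀ t ∈ X, ¬ (openGraph ω).Reachable s t} → φ ω = φ (ω \ {e : Sym2 V | ∃ v ∈ e, v = s ∨ ∃ e' ∈ openEdgeCluster ω s, v ∈ e'})) :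
    ∑ ω, weight w ω * (H (openEdgeCluster ω s) * φ ω * ind ({ω : Set (Sym2 V) | ∀ t ∈ X, ¬ (openGraph ω).Reachable s t}) ω) =
      ∑ ω, weight w ω * (H (openEdgeCluster ω s) * (∑ η, weight w η * φ (η \ {e : Sym2 V | ∃ v ∈ e, v = s ∨ ∃ e' ∈ openEdgeCluster ω s, v ∈ e'})) * ind ({ω : Set (Sym2 V) | ∀ t ∈ X, ¬ (openGraph ω).Reachable s t}) ω) := by
  set dD : Set (Sym2 V) → ℝ := fun W => if (∀ x ∈ X, ¬ (x = s ∨ ∃ e ∈ W, x ∈ e)) then 1 else 0 with hdD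
  have hind : ∀ ω, ind ({ω : Set (Sym2 V) | ∀ t ∈ X, ¬ (openGraph ω).Reachable s t}) ω = dD (openEdgeCluster ω s) := fun ω => by rw [hdD]; exact ind_Dis_eq s X ω
  have key := sum_cluster_fubini w hm s (fun W ζ => H W * φ ζ * dD W)
  have lhs : ∀ ω, weight w ω * (H (openEdgeCluster ω s) * φ ω * ind ({ω : Set (Sym2 V) | ∀ t ∈ X, ¬ (openGraph ω).Reachable s t}) ω) =
      weight w ω * (H (openEdgeCluster ω s) * φ (ω \ {e : Sym2 V | ∃ v ∈ e, v = s ∨ ∃ e' ∈ openEdgeCluster ω s, v ∈ e'}) * dD (openEdgeCluster ω s)) := by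
    intro ω
    rw [hind]
    by_cases h : ω ∈ {ω : Set (Sym2 V) | ∀ t ∈ X, ¬ (openGraph ω).Reachable s t}
    · rw [← hφ ω h]
    · have : dD (openEdgeCluster ω s) = 0 := by rw [← hind, ind_of_not_mem h]
      rw [this, mul_zero, mul_zero, mul_zero, mul_zero]
  have rhs : ∀ ω, weight w ω * (H (openEdgeCluster ω s) * (∑ η, weight w η * φ (η \ {e : Sym2 V | ∃ v ∈ e, v = s ∨ ∃ e' ∈ openEdgeCluster ω s, v ∈ e'})) * ind ({ω : Set (Sym2 V) | ∀ t ∈ X, ¬ (openGraph ω).Reachable s t}) ω) =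
      weight w ω * ∑ η, weight w η *
        (H (openEdgeCluster ω s) * φ (η \ {e : Sym2 V | ∃ v ∈ e, v = s ∨ ∃ e' ∈ openEdgeCluster ω s, v ∈ e'}) * dD (openEdgeCluster ω s)) := by
    intro ω
    rw [hind]
    have : H (openEdgeCluster ω s) * (∑ η, weight w η * φ (η \ {e : Sym2 V | ∃ v ∈ e, v = s ∨ ∃ e' ∈ openEdgeCluster ω s, v ∈ e'})) * dD (openEdgeCluster ω s) =
        ∑ η, weight w η * (H (openEdgeCluster ω s) * φ (η \ {e : Sym2 V | ∃ v ∈ e, v = s ∨ ∃ e' ∈ openEdgeCluster ω s, v ∈ e'}) * dD (openEdgeCluster ω s)) := by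
      simp only [Finset.mul_sum, Finset.sum_mul]
      exact Finset.sum_congr rfl fun η _ => by ring
    rw [this]
  rw [Finset.sum_congr rfl fun ω _ => lhs ω, Finset.sum_congr rfl fun ω _ => rhs ω]
  exact key

/-- Special case `H = 1`: `E[φ ; D] = E[cond φ (C_s) ; D]`. [cite: VandenbergHaggstromKahn2005, §1 pp. 7–8] -/
theorem sum_offCluster_eq_cond' (w : Sym2 V → ℝ) (hm : ∑ ω, weight w ω = 1) (s : V) (X : Set V)
    (φ : Set (Sym2 V) → ℝ) (hφ : ∀ ω, ω ∈ {ω : Set (Sym2 V) | ∀ t ∈ X, ¬ (openGraph ω).Reachable s t} → φ ω = φ (ω \ {e : Sym2 V | ∃ v ∈ e, v = s ∨ ∃ e' ∈ openEdgeCluster ω s, v ∈ e'})) :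
    ∑ ω, weight w ω * (φ ω * ind ({ω : Set (Sym2 V) | ∀ t ∈ X, ¬ (openGraph ω).Reachable s t}) ω) =
      ∑ ω, weight w ω * ((∑ η, weight w η * φ (η \ {e : Sym2 V | ∃ v ∈ e, v = s ∨ ∃ e' ∈ openEdgeCluster ω s, v ∈ e'})) * ind ({ω : Set (Sym2 V) | ∀ t ∈ X, ¬ (openGraph ω).Reachable s t}) ω) := by
  have := sum_offCluster_eq_cond w hm s X (fun _ => 1) φ hφ
  simpa only [one_mul] using this

/-! ## Monotonicity of conditional averages and Harris in the fresh variables -/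

/-- `cond φ` is antitone in `W` for increasing `φ` ("`E[f | C_s = W]` is monotone in `W`").
[cite: VandenbergHaggstromKahn2005, §1 p. 8] -/
theorem cond_antitone {w : Sym2 V → ℝ} (hw0 : ∀ e, 0 ≤ w e) (hw1 : ∀ e, w e ≤ 1) (s : V)
    {φ : Set (Sym2 V) → ℝ} (hφ : Monotone φ) : Antitone (fun W : Set (Sym2 V) => (∑ η, weight w η * φ (η \ {e : Sym2 V | ∃ v ∈ e, v = s ∨ ∃ e' ∈ W, v ∈ e'}))) := by
  intro W W' hWW'
  refine Finset.sum_le_sum fun η _ => mul_le_mul_of_nonneg_left ?_ (weight_nonneg hw0 hw1 η)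
  exact hφ (Set.sdiff_subset_sdiff_right (bar_mono' s hWW'))

/-- `cond ψ` is monotone in `W` for decreasing `ψ`. [cite: VandenbergHaggstromKahn2005, §1 p. 8] -/
theorem cond_monotone {w : Sym2 V → ℝ} (hw0 : ∀ e, 0 ≤ w e) (hw1 : ∀ e, w e ≤ 1) (s : V)
    {ψ : Set (Sym2 V) → ℝ} (hψ : Antitone ψ) : Monotone (fun W : Set (Sym2 V) => (∑ η, weight w η * ψ (η \ {e : Sym2 V | ∃ v ∈ e, v = s ∨ ∃ e' ∈ W, v ∈ e'}))) := by
  intro W W' hWW'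
  refine Finset.sum_le_sum fun η _ => mul_le_mul_of_nonneg_left ?_ (weight_nonneg hw0 hw1 η)
  exact hψ (Set.sdiff_subset_sdiff_right (bar_mono' s hWW'))

/-- Harris in the fresh variables, both increasing: `cond (φψ) ≥ cond φ · cond ψ`.
[cite: VandenbergHaggstromKahn2005, §1 p. 8 ("by Harris' inequality")] -/
theorem cond_mul_le_cond_mul {w : Sym2 V → ℝ} (hw0 : ∀ e, 0 ≤ w e) (hw1 : ∀ e, w e ≤ 1)
    (hm : ∑ ω, weight w ω = 1) (s : V) {φ ψ : Set (Sym2 V) → ℝ} (hφ : Monotone φ) (hψ : Monotone ψ)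
    (hφ0 : ∀ a, 0 ≤ φ a) (hψ0 : ∀ a, 0 ≤ ψ a) (W : Set (Sym2 V)) :
    (∑ η, weight w η * φ (η \ {e : Sym2 V | ∃ v ∈ e, v = s ∨ ∃ e' ∈ W, v ∈ e'})) * (∑ η, weight w η * ψ (η \ {e : Sym2 V | ∃ v ∈ e, v = s ∨ ∃ e' ∈ W, v ∈ e'})) ≤ (∑ η, weight w η * (fun ζ => φ ζ * ψ ζ) (η \ {e : Sym2 V | ∃ v ∈ e, v = s ∨ ∃ e' ∈ W, v ∈ e'})) := by
  have h := harris hw0 hw1 (f := fun η => φ (η \ {e : Sym2 V | ∃ v ∈ e, v = s ∨ ∃ e' ∈ W, v ∈ e'})) (g := fun η => ψ (η \ {e : Sym2 V | ∃ v ∈ e, v = s ∨ ∃ e' ∈ W, v ∈ e'}))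
    (fun _ => hφ0 _) (fun _ => hψ0 _)
    (fun _ _ hab => hφ (Set.sdiff_subset_sdiff_left hab)) (fun _ _ hab => hψ (Set.sdiff_subset_sdiff_left hab))
  rw [hm, one_mul] at h
  exact h

/-- Harris in the fresh variables, increasing × decreasing: `cond (φψ) ≤ cond φ · cond ψ`.
[cite: VandenbergHaggstromKahn2005, §1 p. 8] -/
theorem cond_mul_ge_cond_mul {w : Sym2 V → ℝ} (hw0 : ∀ e, 0 ≤ w e) (hw1 : ∀ e, w e ≤ 1)
    (hm : ∑ ω, weight w ω = 1) (s : V) {φ ψ : Set (Sym2 V) → ℝ} (hφ : Monotone φ) (hψ : Antitone ψ)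
    (hφ0 : ∀ a, 0 ≤ φ a) {M : ℝ} (hψM : ∀ a, ψ a ≤ M) (W : Set (Sym2 V)) :
    (∑ η, weight w η * (fun ζ => φ ζ * ψ ζ) (η \ {e : Sym2 V | ∃ v ∈ e, v = s ∨ ∃ e' ∈ W, v ∈ e'})) ≤ (∑ η, weight w η * φ (η \ {e : Sym2 V | ∃ v ∈ e, v = s ∨ ∃ e' ∈ W, v ∈ e'})) * (∑ η, weight w η * ψ (η \ {e : Sym2 V | ∃ v ∈ e, v = s ∨ ∃ e' ∈ W, v ∈ e'})) :=
  harris_mono_anti hw0 hw1 hm (f := fun η => φ (η \ {e : Sym2 V | ∃ v ∈ e, v = s ∨ ∃ e' ∈ W, v ∈ e'})) (g := fun η => ψ (η \ {e : Sym2 V | ∃ v ∈ e, v = s ∨ ∃ e' ∈ W, v ∈ e'}))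
    (fun _ => hφ0 _) (fun _ _ hab => hφ (Set.sdiff_subset_sdiff_left hab))
    (fun _ _ hab => hψ (Set.sdiff_subset_sdiff_left hab)) (fun _ => hψM _)

/-! ## Theorem 1.3 in finite-sum form -/

omit [Fintype V] in
/-- `0 ≤ w e`. [folklore] -/
theorem wr_nonneg (w : Sym2 V → unitInterval) (e : Sym2 V) : 0 ≤ (fun e => ((w e : unitInterval) : ℝ)) e := (w e).2.1
omit [Fintype V] in
/-- `w e ≤ 1`. [folklore] -/
theorem wr_le_one (w : Sym2 V → unitInterval) (e : Sym2 V) : (fun e => ((w e : unitInterval) : ℝ)) e ≤ 1 := (w e).2.2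

/-- The weights sum to one. [folklore] -/
theorem sum_weight_wr (w : Sym2 V → unitInterval) : ∑ ω, weight (fun e => ((w e : unitInterval) : ℝ)) ω = 1 := by
  have h1 := integral_prodBernoulli_eq_sum w fun _ => (1 : ℝ)
  simp only [integral_const, probReal_univ, smul_eq_mul, mul_one] at h1
  exact h1.symm

/-- Restricted integrals as weighted sums. [folklore] -/
theorem setIntegral_eq_sum (w : Sym2 V → unitInterval) (D : Set (Set (Sym2 V))) (h : Set (Sym2 V) → ℝ) :
    ∫ ω in D, h ω ∂(prodBernoulli w) = ∑ ω, weight (fun e => ((w e : unitInterval) : ℝ)) ω * (h ω * ind D ω) := by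
  have hDm : MeasurableSet D := MeasurableSet.of_discrete
  rw [← integral_indicator hDm, integral_prodBernoulli_eq_sum]
  refine Finset.sum_congr rfl fun ω _ => ?_
  by_cases hω : ω ∈ D
  · rw [Set.indicator_of_mem hω, ind_of_mem hω, mul_one]
  · rw [Set.indicator_of_notMem hω, ind_of_not_mem hω]; ring

/-- Probabilities as weighted sums. [folklore] -/
theorem measureReal_eq_sum (w : Sym2 V → unitInterval) (D : Set (Set (Sym2 V))) :
    (prodBernoulli w).real D = ∑ ω, weight (fun e => ((w e : unitInterval) : ℝ)) ω * ind D ω := by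
  have hDm : MeasurableSet D := MeasurableSet.of_discrete
  rw [← integral_indicator_one hDm, integral_prodBernoulli_eq_sum]
  refine Finset.sum_congr rfl fun ω _ => ?_
  by_cases hω : ω ∈ D
  · rw [Set.indicator_of_mem hω, ind_of_mem hω, Pi.one_apply]
  · rw [Set.indicator_of_notMem hω, ind_of_not_mem hω, mul_zero]

/-- **BHK Theorem 1.3, finite-sum form**: for monotone `F, G` (functions of `C_s`) and `s ∉ X`,
`E[F(C_s); D] · E[G(C_s); D] ≤ P(D) · E[F(C_s) G(C_s); D]`, `D = {s ↮ X}`.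
[cite: VandenbergHaggstromKahn2005, Thm. 1.3 (p. 6)] -/
theorem thm13_sum (w : Sym2 V → unitInterval) (s : V) (X : Set V) (hs : s ∉ X)
    (F G : Set (Sym2 V) → ℝ) (hF : Monotone F) (hG : Monotone G) :
    (∑ ω, weight (fun e => ((w e : unitInterval) : ℝ)) ω * (F (openEdgeCluster ω s) * ind ({ω : Set (Sym2 V) | ∀ t ∈ X, ¬ (openGraph ω).Reachable s t}) ω)) *
        (∑ ω, weight (fun e => ((w e : unitInterval) : ℝ)) ω * (G (openEdgeCluster ω s) * ind ({ω : Set (Sym2 V) | ∀ t ∈ X, ¬ (openGraph ω).Reachable s t}) ω)) ≤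
      (∑ ω, weight (fun e => ((w e : unitInterval) : ℝ)) ω * ind ({ω : Set (Sym2 V) | ∀ t ∈ X, ¬ (openGraph ω).Reachable s t}) ω) *
        ∑ ω, weight (fun e => ((w e : unitInterval) : ℝ)) ω * (F (openEdgeCluster ω s) * G (openEdgeCluster ω s) * ind ({ω : Set (Sym2 V) | ∀ t ∈ X, ¬ (openGraph ω).Reachable s t}) ω) := by
  have key := BHK2006_clusterConditionalPositiveAssociation_holds V w s X F G hF hG hs
  rw [setIntegral_eq_sum, setIntegral_eq_sum, setIntegral_eq_sum w _ (fun ω => F (openEdgeCluster ω s) * G (openEdgeCluster ω s)),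
    measureReal_eq_sum] at key
  exact key
/-! ## The four conditional correlation inequalities -/

/-- **Given `{s ↮ X}`, an increasing function of `C_s` and an increasing function living off `C_s` are negatively
correlated**: `P(D) E[g(C_s) φ; D] ≤ E[g(C_s); D] E[φ; D]`. [this work] -/
theorem condHarris_cluster_mono_off_mono (w : Sym2 V → unitInterval) (s : V) (X : Set V) (hs : s ∉ X)
    {g : Set (Sym2 V) → ℝ} (hg : Monotone g) {φ : Set (Sym2 V) → ℝ} (hφ : Monotone φ)
    (hoff : ∀ ω, ω ∈ {ω : Set (Sym2 V) | ∀ t ∈ X, ¬ (openGraph ω).Reachable s t} → φ ω = φ (ω \ {e : Sym2 V | ∃ v ∈ e, v = s ∨ ∃ e' ∈ openEdgeCluster ω s, v ∈ e'})) :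
    (∑ ω, weight (fun e => ((w e : unitInterval) : ℝ)) ω * ind ({ω : Set (Sym2 V) | ∀ t ∈ X, ¬ (openGraph ω).Reachable s t}) ω) *
        ∑ ω, weight (fun e => ((w e : unitInterval) : ℝ)) ω * (g (openEdgeCluster ω s) * φ ω * ind ({ω : Set (Sym2 V) | ∀ t ∈ X, ¬ (openGraph ω).Reachable s t}) ω) ≤
      (∑ ω, weight (fun e => ((w e : unitInterval) : ℝ)) ω * (g (openEdgeCluster ω s) * ind ({ω : Set (Sym2 V) | ∀ t ∈ X, ¬ (openGraph ω).Reachable s t}) ω)) *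
        ∑ ω, weight (fun e => ((w e : unitInterval) : ℝ)) ω * (φ ω * ind ({ω : Set (Sym2 V) | ∀ t ∈ X, ¬ (openGraph ω).Reachable s t}) ω) := by
  have hm := sum_weight_wr w
  rw [sum_offCluster_eq_cond (fun e => ((w e : unitInterval) : ℝ)) hm s X g φ hoff, sum_offCluster_eq_cond' (fun e => ((w e : unitInterval) : ℝ)) hm s X φ hoff]
  have hanti : Antitone (fun W : Set (Sym2 V) => (∑ η, weight (fun e => ((w e : unitInterval) : ℝ)) η * φ (η \ {e : Sym2 V | ∃ v ∈ e, v = s ∨ ∃ e' ∈ W, v ∈ e'}))) := cond_antitone (wr_nonneg w) (wr_le_one w) s hφ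
  have key := thm13_sum w s X hs g (fun W : Set (Sym2 V) => - (∑ η, weight (fun e => ((w e : unitInterval) : ℝ)) η * φ (η \ {e : Sym2 V | ∃ v ∈ e, v = s ∨ ∃ e' ∈ W, v ∈ e'}))) hg (fun _ _ h => neg_le_neg (hanti h))
  have e1 : ∑ ω, weight (fun e => ((w e : unitInterval) : ℝ)) ω * (-(∑ η, weight (fun e => ((w e : unitInterval) : ℝ)) η * φ (η \ {e : Sym2 V | ∃ v ∈ e, v = s ∨ ∃ e' ∈ openEdgeCluster ω s, v ∈ e'})) * ind ({ω : Set (Sym2 V) | ∀ t ∈ X, ¬ (openGraph ω).Reachable s t}) ω) =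
      -∑ ω, weight (fun e => ((w e : unitInterval) : ℝ)) ω * ((∑ η, weight (fun e => ((w e : unitInterval) : ℝ)) η * φ (η \ {e : Sym2 V | ∃ v ∈ e, v = s ∨ ∃ e' ∈ openEdgeCluster ω s, v ∈ e'})) * ind ({ω : Set (Sym2 V) | ∀ t ∈ X, ¬ (openGraph ω).Reachable s t}) ω) := by
    rw [← Finset.sum_neg_distrib]; exact Finset.sum_congr rfl fun ω _ => by ring
  have e2 : ∑ ω, weight (fun e => ((w e : unitInterval) : ℝ)) ω * (g (openEdgeCluster ω s) * -(∑ η, weight (fun e => ((w e : unitInterval) : ℝ)) η * φ (η \ {e : Sym2 V | ∃ v ∈ e, v = s ∨ ∃ e' ∈ openEdgeCluster ω s, v ∈ e'})) * ind ({ω : Set (Sym2 V) | ∀ t ∈ X, ¬ (openGraph ω).Reachable s t}) ω) =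
      -∑ ω, weight (fun e => ((w e : unitInterval) : ℝ)) ω * (g (openEdgeCluster ω s) * (∑ η, weight (fun e => ((w e : unitInterval) : ℝ)) η * φ (η \ {e : Sym2 V | ∃ v ∈ e, v = s ∨ ∃ e' ∈ openEdgeCluster ω s, v ∈ e'})) * ind ({ω : Set (Sym2 V) | ∀ t ∈ X, ¬ (openGraph ω).Reachable s t}) ω) := by
    rw [← Finset.sum_neg_distrib]; exact Finset.sum_congr rfl fun ω _ => by ring
  rw [e1, e2] at key
  linarith

/-- **Given `{s ↮ X}`, a decreasing function of `C_s` and an increasing function living off `C_s` are positively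
correlated**: `E[g(C_s); D] E[φ; D] ≤ P(D) E[g(C_s) φ; D]`. [this work] -/
theorem condHarris_cluster_anti_off_mono (w : Sym2 V → unitInterval) (s : V) (X : Set V) (hs : s ∉ X)
    {g : Set (Sym2 V) → ℝ} (hg : Antitone g) {φ : Set (Sym2 V) → ℝ} (hφ : Monotone φ)
    (hoff : ∀ ω, ω ∈ {ω : Set (Sym2 V) | ∀ t ∈ X, ¬ (openGraph ω).Reachable s t} → φ ω = φ (ω \ {e : Sym2 V | ∃ v ∈ e, v = s ∨ ∃ e' ∈ openEdgeCluster ω s, v ∈ e'})) :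
    (∑ ω, weight (fun e => ((w e : unitInterval) : ℝ)) ω * (g (openEdgeCluster ω s) * ind ({ω : Set (Sym2 V) | ∀ t ∈ X, ¬ (openGraph ω).Reachable s t}) ω)) *
        (∑ ω, weight (fun e => ((w e : unitInterval) : ℝ)) ω * (φ ω * ind ({ω : Set (Sym2 V) | ∀ t ∈ X, ¬ (openGraph ω).Reachable s t}) ω)) ≤
      (∑ ω, weight (fun e => ((w e : unitInterval) : ℝ)) ω * ind ({ω : Set (Sym2 V) | ∀ t ∈ X, ¬ (openGraph ω).Reachable s t}) ω) *
        ∑ ω, weight (fun e => ((w e : unitInterval) : ℝ)) ω * (g (openEdgeCluster ω s) * φ ω * ind ({ω : Set (Sym2 V) | ∀ t ∈ X, ¬ (openGraph ω).Reachable s t}) ω) := by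
  have hm := sum_weight_wr w
  rw [sum_offCluster_eq_cond (fun e => ((w e : unitInterval) : ℝ)) hm s X g φ hoff, sum_offCluster_eq_cond' (fun e => ((w e : unitInterval) : ℝ)) hm s X φ hoff]
  have hanti : Antitone (fun W : Set (Sym2 V) => (∑ η, weight (fun e => ((w e : unitInterval) : ℝ)) η * φ (η \ {e : Sym2 V | ∃ v ∈ e, v = s ∨ ∃ e' ∈ W, v ∈ e'}))) := cond_antitone (wr_nonneg w) (wr_le_one w) s hφ
  have key := thm13_sum w s X hs (fun W => - g W) (fun W : Set (Sym2 V) => - (∑ η, weight (fun e => ((w e : unitInterval) : ℝ)) η * φ (η \ {e : Sym2 V | ∃ v ∈ e, v = s ∨ ∃ e' ∈ W, v ∈ e'})))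
    (fun _ _ h => neg_le_neg (hg h)) (fun _ _ h => neg_le_neg (hanti h))
  have e1 : ∑ ω, weight (fun e => ((w e : unitInterval) : ℝ)) ω * (-(∑ η, weight (fun e => ((w e : unitInterval) : ℝ)) η * φ (η \ {e : Sym2 V | ∃ v ∈ e, v = s ∨ ∃ e' ∈ openEdgeCluster ω s, v ∈ e'})) * ind ({ω : Set (Sym2 V) | ∀ t ∈ X, ¬ (openGraph ω).Reachable s t}) ω) =
      -∑ ω, weight (fun e => ((w e : unitInterval) : ℝ)) ω * ((∑ η, weight (fun e => ((w e : unitInterval) : ℝ)) η * φ (η \ {e : Sym2 V | ∃ v ∈ e, v = s ∨ ∃ e' ∈ openEdgeCluster ω s, v ∈ e'})) * ind ({ω : Set (Sym2 V) | ∀ t ∈ X, ¬ (openGraph ω).Reachable s t}) ω) := by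
    rw [← Finset.sum_neg_distrib]; exact Finset.sum_congr rfl fun ω _ => by ring
  have e2 : ∑ ω, weight (fun e => ((w e : unitInterval) : ℝ)) ω * (-g (openEdgeCluster ω s) * ind ({ω : Set (Sym2 V) | ∀ t ∈ X, ¬ (openGraph ω).Reachable s t}) ω) =
      -∑ ω, weight (fun e => ((w e : unitInterval) : ℝ)) ω * (g (openEdgeCluster ω s) * ind ({ω : Set (Sym2 V) | ∀ t ∈ X, ¬ (openGraph ω).Reachable s t}) ω) := by
    rw [← Finset.sum_neg_distrib]; exact Finset.sum_congr rfl fun ω _ => by ring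
  have e3 : ∑ ω, weight (fun e => ((w e : unitInterval) : ℝ)) ω * (-g (openEdgeCluster ω s) * -(∑ η, weight (fun e => ((w e : unitInterval) : ℝ)) η * φ (η \ {e : Sym2 V | ∃ v ∈ e, v = s ∨ ∃ e' ∈ openEdgeCluster ω s, v ∈ e'})) * ind ({ω : Set (Sym2 V) | ∀ t ∈ X, ¬ (openGraph ω).Reachable s t}) ω) =
      ∑ ω, weight (fun e => ((w e : unitInterval) : ℝ)) ω * (g (openEdgeCluster ω s) * (∑ η, weight (fun e => ((w e : unitInterval) : ℝ)) η * φ (η \ {e : Sym2 V | ∃ v ∈ e, v = s ∨ ∃ e' ∈ openEdgeCluster ω s, v ∈ e'})) * ind ({ω : Set (Sym2 V) | ∀ t ∈ X, ¬ (openGraph ω).Reachable s t}) ω) :=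
    Finset.sum_congr rfl fun ω _ => by ring
  rw [e1, e2, e3] at key
  linarith

/-- **Given `{s ↮ X}`, two nonnegative increasing functions living off `C_s` are positively correlated**:
`E[φ; D] E[ψ; D] ≤ P(D) E[φ ψ; D]`. [this work] -/
theorem condHarris_off_mono_mono (w : Sym2 V → unitInterval) (s : V) (X : Set V) (hs : s ∉ X)
    {φ ψ : Set (Sym2 V) → ℝ} (hφ : Monotone φ) (hψ : Monotone ψ) (hφ0 : ∀ a, 0 ≤ φ a) (hψ0 : ∀ a, 0 ≤ ψ a)
    (hoffφ : ∀ ω, ω ∈ {ω : Set (Sym2 V) | ∀ t ∈ X, ¬ (openGraph ω).Reachable s t} → φ ω = φ (ω \ {e : Sym2 V | ∃ v ∈ e, v = s ∨ ∃ e' ∈ openEdgeCluster ω s, v ∈ e'}))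
    (hoffψ : ∀ ω, ω ∈ {ω : Set (Sym2 V) | ∀ t ∈ X, ¬ (openGraph ω).Reachable s t} → ψ ω = ψ (ω \ {e : Sym2 V | ∃ v ∈ e, v = s ∨ ∃ e' ∈ openEdgeCluster ω s, v ∈ e'})) :
    (∑ ω, weight (fun e => ((w e : unitInterval) : ℝ)) ω * (φ ω * ind ({ω : Set (Sym2 V) | ∀ t ∈ X, ¬ (openGraph ω).Reachable s t}) ω)) * (∑ ω, weight (fun e => ((w e : unitInterval) : ℝ)) ω * (ψ ω * ind ({ω : Set (Sym2 V) | ∀ t ∈ X, ¬ (openGraph ω).Reachable s t}) ω)) ≤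
      (∑ ω, weight (fun e => ((w e : unitInterval) : ℝ)) ω * ind ({ω : Set (Sym2 V) | ∀ t ∈ X, ¬ (openGraph ω).Reachable s t}) ω) * ∑ ω, weight (fun e => ((w e : unitInterval) : ℝ)) ω * (φ ω * ψ ω * ind ({ω : Set (Sym2 V) | ∀ t ∈ X, ¬ (openGraph ω).Reachable s t}) ω) := by
  have hm := sum_weight_wr w; have hw0 := wr_nonneg w; have hw1 := wr_le_one w
  have hoff2 : ∀ ω, ω ∈ {ω : Set (Sym2 V) | ∀ t ∈ X, ¬ (openGraph ω).Reachable s t} → (fun ζ => φ ζ * ψ ζ) ω = (fun ζ => φ ζ * ψ ζ) (ω \ {e : Sym2 V | ∃ v ∈ e, v = s ∨ ∃ e' ∈ openEdgeCluster ω s, v ∈ e'}) :=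
    fun ω hω => by simp only; rw [← hoffφ ω hω, ← hoffψ ω hω]
  rw [sum_offCluster_eq_cond' (fun e => ((w e : unitInterval) : ℝ)) hm s X φ hoffφ, sum_offCluster_eq_cond' (fun e => ((w e : unitInterval) : ℝ)) hm s X ψ hoffψ,
    sum_offCluster_eq_cond' (fun e => ((w e : unitInterval) : ℝ)) hm s X (fun ζ => φ ζ * ψ ζ) hoff2]
  have hantiφ : Antitone (fun W : Set (Sym2 V) => (∑ η, weight (fun e => ((w e : unitInterval) : ℝ)) η * φ (η \ {e : Sym2 V | ∃ v ∈ e, v = s ∨ ∃ e' ∈ W, v ∈ e'}))) := cond_antitone hw0 hw1 s hφ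
  have hantiψ : Antitone (fun W : Set (Sym2 V) => (∑ η, weight (fun e => ((w e : unitInterval) : ℝ)) η * ψ (η \ {e : Sym2 V | ∃ v ∈ e, v = s ∨ ∃ e' ∈ W, v ∈ e'}))) := cond_antitone hw0 hw1 s hψ
  -- Harris in the fresh variables, termwise
  have step1 : ∑ ω, weight (fun e => ((w e : unitInterval) : ℝ)) ω * ((∑ η, weight (fun e => ((w e : unitInterval) : ℝ)) η * φ (η \ {e : Sym2 V | ∃ v ∈ e, v = s ∨ ∃ e' ∈ openEdgeCluster ω s, v ∈ e'})) * (∑ η, weight (fun e => ((w e : unitInterval) : ℝ)) η * ψ (η \ {e : Sym2 V | ∃ v ∈ e, v = s ∨ ∃ e' ∈ openEdgeCluster ω s, v ∈ e'}))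
        * ind ({ω : Set (Sym2 V) | ∀ t ∈ X, ¬ (openGraph ω).Reachable s t}) ω) ≤
      ∑ ω, weight (fun e => ((w e : unitInterval) : ℝ)) ω * ((∑ η, weight (fun e => ((w e : unitInterval) : ℝ)) η * (fun ζ => φ ζ * ψ ζ) (η \ {e : Sym2 V | ∃ v ∈ e, v = s ∨ ∃ e' ∈ openEdgeCluster ω s, v ∈ e'})) * ind ({ω : Set (Sym2 V) | ∀ t ∈ X, ¬ (openGraph ω).Reachable s t}) ω) :=
    Finset.sum_le_sum fun ω _ => mul_le_mul_of_nonneg_left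
      (mul_le_mul_of_nonneg_right (cond_mul_le_cond_mul hw0 hw1 hm s hφ hψ hφ0 hψ0 _) (ind_nonneg _ _))
      (weight_nonneg hw0 hw1 ω)
  -- Theorem 1.3 for the two antitone conditional averages
  have key := thm13_sum w s X hs (fun W : Set (Sym2 V) => - (∑ η, weight (fun e => ((w e : unitInterval) : ℝ)) η * φ (η \ {e : Sym2 V | ∃ v ∈ e, v = s ∨ ∃ e' ∈ W, v ∈ e'}))) (fun W : Set (Sym2 V) => - (∑ η, weight (fun e => ((w e : unitInterval) : ℝ)) η * ψ (η \ {e : Sym2 V | ∃ v ∈ e, v = s ∨ ∃ e' ∈ W, v ∈ e'})))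
    (fun _ _ h => neg_le_neg (hantiφ h)) (fun _ _ h => neg_le_neg (hantiψ h))
  have e1 : ∑ ω, weight (fun e => ((w e : unitInterval) : ℝ)) ω * (-(∑ η, weight (fun e => ((w e : unitInterval) : ℝ)) η * φ (η \ {e : Sym2 V | ∃ v ∈ e, v = s ∨ ∃ e' ∈ openEdgeCluster ω s, v ∈ e'})) * ind ({ω : Set (Sym2 V) | ∀ t ∈ X, ¬ (openGraph ω).Reachable s t}) ω) =
      -∑ ω, weight (fun e => ((w e : unitInterval) : ℝ)) ω * ((∑ η, weight (fun e => ((w e : unitInterval) : ℝ)) η * φ (η \ {e : Sym2 V | ∃ v ∈ e, v = s ∨ ∃ e' ∈ openEdgeCluster ω s, v ∈ e'})) * ind ({ω : Set (Sym2 V) | ∀ t ∈ X, ¬ (openGraph ω).Reachable s t}) ω) := by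
    rw [← Finset.sum_neg_distrib]; exact Finset.sum_congr rfl fun ω _ => by ring
  have e2 : ∑ ω, weight (fun e => ((w e : unitInterval) : ℝ)) ω * (-(∑ η, weight (fun e => ((w e : unitInterval) : ℝ)) η * ψ (η \ {e : Sym2 V | ∃ v ∈ e, v = s ∨ ∃ e' ∈ openEdgeCluster ω s, v ∈ e'})) * ind ({ω : Set (Sym2 V) | ∀ t ∈ X, ¬ (openGraph ω).Reachable s t}) ω) =
      -∑ ω, weight (fun e => ((w e : unitInterval) : ℝ)) ω * ((∑ η, weight (fun e => ((w e : unitInterval) : ℝ)) η * ψ (η \ {e : Sym2 V | ∃ v ∈ e, v = s ∨ ∃ e' ∈ openEdgeCluster ω s, v ∈ e'})) * ind ({ω : Set (Sym2 V) | ∀ t ∈ X, ¬ (openGraph ω).Reachable s t}) ω) := by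
    rw [← Finset.sum_neg_distrib]; exact Finset.sum_congr rfl fun ω _ => by ring
  have e3 : ∑ ω, weight (fun e => ((w e : unitInterval) : ℝ)) ω * (-(∑ η, weight (fun e => ((w e : unitInterval) : ℝ)) η * φ (η \ {e : Sym2 V | ∃ v ∈ e, v = s ∨ ∃ e' ∈ openEdgeCluster ω s, v ∈ e'})) * -(∑ η, weight (fun e => ((w e : unitInterval) : ℝ)) η * ψ (η \ {e : Sym2 V | ∃ v ∈ e, v = s ∨ ∃ e' ∈ openEdgeCluster ω s, v ∈ e'}))
        * ind ({ω : Set (Sym2 V) | ∀ t ∈ X, ¬ (openGraph ω).Reachable s t}) ω) =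
      ∑ ω, weight (fun e => ((w e : unitInterval) : ℝ)) ω * ((∑ η, weight (fun e => ((w e : unitInterval) : ℝ)) η * φ (η \ {e : Sym2 V | ∃ v ∈ e, v = s ∨ ∃ e' ∈ openEdgeCluster ω s, v ∈ e'})) * (∑ η, weight (fun e => ((w e : unitInterval) : ℝ)) η * ψ (η \ {e : Sym2 V | ∃ v ∈ e, v = s ∨ ∃ e' ∈ openEdgeCluster ω s, v ∈ e'}))
        * ind ({ω : Set (Sym2 V) | ∀ t ∈ X, ¬ (openGraph ω).Reachable s t}) ω) := Finset.sum_congr rfl fun ω _ => by ring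
  rw [e1, e2, e3] at key
  have hP : 0 ≤ ∑ ω, weight (fun e => ((w e : unitInterval) : ℝ)) ω * ind ({ω : Set (Sym2 V) | ∀ t ∈ X, ¬ (openGraph ω).Reachable s t}) ω :=
    Finset.sum_nonneg fun ω _ => mul_nonneg (weight_nonneg hw0 hw1 ω) (ind_nonneg _ _)
  nlinarith [mul_le_mul_of_nonneg_left step1 hP]

/-- **Given `{s ↮ X}`, an increasing and a decreasing function living off `C_s` (nonnegative resp. bounded) are
negatively correlated**: `P(D) E[φ ψ; D] ≤ E[φ; D] E[ψ; D]`. [this work] -/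
theorem condHarris_off_mono_anti (w : Sym2 V → unitInterval) (s : V) (X : Set V) (hs : s ∉ X)
    {φ ψ : Set (Sym2 V) → ℝ} (hφ : Monotone φ) (hψ : Antitone ψ) (hφ0 : ∀ a, 0 ≤ φ a) {M : ℝ} (hψM : ∀ a, ψ a ≤ M)
    (hoffφ : ∀ ω, ω ∈ {ω : Set (Sym2 V) | ∀ t ∈ X, ¬ (openGraph ω).Reachable s t} → φ ω = φ (ω \ {e : Sym2 V | ∃ v ∈ e, v = s ∨ ∃ e' ∈ openEdgeCluster ω s, v ∈ e'}))
    (hoffψ : ∀ ω, ω ∈ {ω : Set (Sym2 V) | ∀ t ∈ X, ¬ (openGraph ω).Reachable s t} → ψ ω = ψ (ω \ {e : Sym2 V | ∃ v ∈ e, v = s ∨ ∃ e' ∈ openEdgeCluster ω s, v ∈ e'})) :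
    (∑ ω, weight (fun e => ((w e : unitInterval) : ℝ)) ω * ind ({ω : Set (Sym2 V) | ∀ t ∈ X, ¬ (openGraph ω).Reachable s t}) ω) * (∑ ω, weight (fun e => ((w e : unitInterval) : ℝ)) ω * (φ ω * ψ ω * ind ({ω : Set (Sym2 V) | ∀ t ∈ X, ¬ (openGraph ω).Reachable s t}) ω)) ≤
      (∑ ω, weight (fun e => ((w e : unitInterval) : ℝ)) ω * (φ ω * ind ({ω : Set (Sym2 V) | ∀ t ∈ X, ¬ (openGraph ω).Reachable s t}) ω)) * ∑ ω, weight (fun e => ((w e : unitInterval) : ℝ)) ω * (ψ ω * ind ({ω : Set (Sym2 V) | ∀ t ∈ X, ¬ (openGraph ω).Reachable s t}) ω) := by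
  have hm := sum_weight_wr w; have hw0 := wr_nonneg w; have hw1 := wr_le_one w
  have hoff2 : ∀ ω, ω ∈ {ω : Set (Sym2 V) | ∀ t ∈ X, ¬ (openGraph ω).Reachable s t} → (fun ζ => φ ζ * ψ ζ) ω = (fun ζ => φ ζ * ψ ζ) (ω \ {e : Sym2 V | ∃ v ∈ e, v = s ∨ ∃ e' ∈ openEdgeCluster ω s, v ∈ e'}) :=
    fun ω hω => by simp only; rw [← hoffφ ω hω, ← hoffψ ω hω]
  rw [sum_offCluster_eq_cond' (fun e => ((w e : unitInterval) : ℝ)) hm s X φ hoffφ, sum_offCluster_eq_cond' (fun e => ((w e : unitInterval) : ℝ)) hm s X ψ hoffψ,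
    sum_offCluster_eq_cond' (fun e => ((w e : unitInterval) : ℝ)) hm s X (fun ζ => φ ζ * ψ ζ) hoff2]
  have hantiφ : Antitone (fun W : Set (Sym2 V) => (∑ η, weight (fun e => ((w e : unitInterval) : ℝ)) η * φ (η \ {e : Sym2 V | ∃ v ∈ e, v = s ∨ ∃ e' ∈ W, v ∈ e'}))) := cond_antitone hw0 hw1 s hφ
  have hmonoψ : Monotone (fun W : Set (Sym2 V) => (∑ η, weight (fun e => ((w e : unitInterval) : ℝ)) η * ψ (η \ {e : Sym2 V | ∃ v ∈ e, v = s ∨ ∃ e' ∈ W, v ∈ e'}))) := cond_monotone hw0 hw1 s hψ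
  have step1 : ∑ ω, weight (fun e => ((w e : unitInterval) : ℝ)) ω * ((∑ η, weight (fun e => ((w e : unitInterval) : ℝ)) η * (fun ζ => φ ζ * ψ ζ) (η \ {e : Sym2 V | ∃ v ∈ e, v = s ∨ ∃ e' ∈ openEdgeCluster ω s, v ∈ e'})) * ind ({ω : Set (Sym2 V) | ∀ t ∈ X, ¬ (openGraph ω).Reachable s t}) ω) ≤
      ∑ ω, weight (fun e => ((w e : unitInterval) : ℝ)) ω * ((∑ η, weight (fun e => ((w e : unitInterval) : ℝ)) η * φ (η \ {e : Sym2 V | ∃ v ∈ e, v = s ∨ ∃ e' ∈ openEdgeCluster ω s, v ∈ e'})) * (∑ η, weight (fun e => ((w e : unitInterval) : ℝ)) η * ψ (η \ {e : Sym2 V | ∃ v ∈ e, v = s ∨ ∃ e' ∈ openEdgeCluster ω s, v ∈ e'}))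
        * ind ({ω : Set (Sym2 V) | ∀ t ∈ X, ¬ (openGraph ω).Reachable s t}) ω) :=
    Finset.sum_le_sum fun ω _ => mul_le_mul_of_nonneg_left
      (mul_le_mul_of_nonneg_right (cond_mul_ge_cond_mul hw0 hw1 hm s hφ hψ hφ0 hψM _) (ind_nonneg _ _))
      (weight_nonneg hw0 hw1 ω)
  have key := thm13_sum w s X hs (fun W : Set (Sym2 V) => (∑ η, weight (fun e => ((w e : unitInterval) : ℝ)) η * ψ (η \ {e : Sym2 V | ∃ v ∈ e, v = s ∨ ∃ e' ∈ W, v ∈ e'}))) (fun W : Set (Sym2 V) => - (∑ η, weight (fun e => ((w e : unitInterval) : ℝ)) η * φ (η \ {e : Sym2 V | ∃ v ∈ e, v = s ∨ ∃ e' ∈ W, v ∈ e'})))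
    hmonoψ (fun _ _ h => neg_le_neg (hantiφ h))
  have e1 : ∑ ω, weight (fun e => ((w e : unitInterval) : ℝ)) ω * (-(∑ η, weight (fun e => ((w e : unitInterval) : ℝ)) η * φ (η \ {e : Sym2 V | ∃ v ∈ e, v = s ∨ ∃ e' ∈ openEdgeCluster ω s, v ∈ e'})) * ind ({ω : Set (Sym2 V) | ∀ t ∈ X, ¬ (openGraph ω).Reachable s t}) ω) =
      -∑ ω, weight (fun e => ((w e : unitInterval) : ℝ)) ω * ((∑ η, weight (fun e => ((w e : unitInterval) : ℝ)) η * φ (η \ {e : Sym2 V | ∃ v ∈ e, v = s ∨ ∃ e' ∈ openEdgeCluster ω s, v ∈ e'})) * ind ({ω : Set (Sym2 V) | ∀ t ∈ X, ¬ (openGraph ω).Reachable s t}) ω) := by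
    rw [← Finset.sum_neg_distrib]; exact Finset.sum_congr rfl fun ω _ => by ring
  have e3 : ∑ ω, weight (fun e => ((w e : unitInterval) : ℝ)) ω * ((∑ η, weight (fun e => ((w e : unitInterval) : ℝ)) η * ψ (η \ {e : Sym2 V | ∃ v ∈ e, v = s ∨ ∃ e' ∈ openEdgeCluster ω s, v ∈ e'})) * -(∑ η, weight (fun e => ((w e : unitInterval) : ℝ)) η * φ (η \ {e : Sym2 V | ∃ v ∈ e, v = s ∨ ∃ e' ∈ openEdgeCluster ω s, v ∈ e'}))
        * ind ({ω : Set (Sym2 V) | ∀ t ∈ X, ¬ (openGraph ω).Reachable s t}) ω) =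
      -∑ ω, weight (fun e => ((w e : unitInterval) : ℝ)) ω * ((∑ η, weight (fun e => ((w e : unitInterval) : ℝ)) η * φ (η \ {e : Sym2 V | ∃ v ∈ e, v = s ∨ ∃ e' ∈ openEdgeCluster ω s, v ∈ e'})) * (∑ η, weight (fun e => ((w e : unitInterval) : ℝ)) η * ψ (η \ {e : Sym2 V | ∃ v ∈ e, v = s ∨ ∃ e' ∈ openEdgeCluster ω s, v ∈ e'}))
        * ind ({ω : Set (Sym2 V) | ∀ t ∈ X, ¬ (openGraph ω).Reachable s t}) ω) := by
    rw [← Finset.sum_neg_distrib]; exact Finset.sum_congr rfl fun ω _ => by ring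
  rw [e1, e3] at key
  have hP : 0 ≤ ∑ ω, weight (fun e => ((w e : unitInterval) : ℝ)) ω * ind ({ω : Set (Sym2 V) | ∀ t ∈ X, ¬ (openGraph ω).Reachable s t}) ω :=
    Finset.sum_nonneg fun ω _ => mul_nonneg (weight_nonneg hw0 hw1 ω) (ind_nonneg _ _)
  nlinarith [mul_le_mul_of_nonneg_left step1 hP]

end CondHarris

end Summit.CriticalPhenomena.PercolationContinuityZ3.Theorems
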